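import Literature.MathematicalPhysics.QuantumManyBody.BoseGasBoundaryConditionIndependence
import HarnessLib

/-!
# Continuity and convexity of the thermodynamic energy density below the critical density

Topic `Literature/MathematicalPhysics/QuantumManyBody`, namespace `…BoseGas`; companion of
`BoseGasThermodynamicLimitRuelle.lean` (Ruelle's subadditivity theory of the Dirichlet energy per
particle `e⁺(ρ) = limsup_N E₀^D(N, L_N)/N`, its almost-midpoint convexity `convexity_ineq` and the
critical density `ρ_c(v)`) and of `BoseGasBoundaryConditionIndependence.lean` (the two-sided
continuity statement `iInf_limsup_le_iSup_limsup_of_lt_criticalDensity`).  We record, for a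
repulsive finite-range `v` and densities below `ρ_c(v)`:

* `limsupEnergyPerParticle_lt_top_of_lt_criticalDensity` — `e⁺(ρ) < ∞` for `ρ < ρ_c`;
* `continuousAt_toReal_limsupEnergyPerParticle` — `ρ ↦ e⁺(ρ)` is continuous on `(0, ρ_c)`
  (monotone with matching one-sided envelopes);
* `midpoint_convexity_energyDensity` — `(y+z) e⁺((y+z)/2) ≤ y e⁺(y) + z e⁺(z)`: the energy
  DENSITY `φ(ρ) = ρ e⁺(ρ)` is midpoint convex (from `convexity_ineq` and continuity);
* `convexOn_of_midpoint_convex_of_continuousOn` — the classical fact that a continuous midpoint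
  convex function on an open interval is convex (maximum principle), whence
  `convexOn_energyDensity : ConvexOn ℝ (Ioo 0 ρ̄) φ` for `ρ̄ ≤ ρ_c`
  [Ruelle1969, Prop. 3.4.4 / §3.5: "`ρ ↦ ρ e(ρ)` is convex"];
* `ofReal_tangent_le_groundStateEnergy` — the use made of convexity by cell arguments: a Dirichlet
  box `Λ_L` with `n ≤ N` particles has energy at least the supporting-line value
  `N e⁺(ρ⋆) - (N - n) S`, `ρ⋆ = N/(L+2R)³`, `S` the chord slope of `φ` between `ρ⋆` and any
  `z > ρ⋆` (Ruelle's basic inequality `limsup_energyPerParticle_le`: `E₀^D(n, L) ≥ n e⁺(n/(L+2R)³)`,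
  then the three-slope inequality).

## References

* [Ruelle1969] D. Ruelle, *Statistical Mechanics: Rigorous Results*, Benjamin 1969, §3.4.4,
  §3.5.11 (convexity and continuity of the thermodynamic energy density).
* [LSSY2005] E. H. Lieb, R. Seiringer, J. P. Solovej, J. Yngvason, *The Mathematics of the Bose
  Gas and its Condensation* (2005), Ch. 2 (2.2).
-/

noncomputable section

open MeasureTheory Filter Topology Set
open scoped ENNReal NNReal

namespace Literature.MathematicalPhysics.QuantumManyBody.BoseGas

/-! ### A continuous midpoint convex function on an open interval is convex -/

/-- **Midpoint convexity plus continuity gives convexity** (open real interval).  Maximum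
principle: on a chord, the excess of `f` over the chord is continuous, vanishes at the ends and is
midpoint convex, so the last point where it attains a positive maximum would propagate the maximum
further right. [folklore] -/
theorem convexOn_of_midpoint_convex_of_continuousOn {f : ℝ → ℝ} {a b : ℝ}
    (hcont : ContinuousOn f (Ioo a b))
    (hmid : ∀ x ∈ Ioo a b, ∀ y ∈ Ioo a b, f ((x + y) / 2) ≤ (f x + f y) / 2) :
    ConvexOn ℝ (Ioo a b) f := by
  refine ⟨convex_Ioo a b, fun x hx y hy p q hp hq hpq => ?_⟩
  -- the chord parametrisation and the excess function
  set pt : ℝ → ℝ := fun t => (1 - t) * x + t * y with hpt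
  set g : ℝ → ℝ := fun t => f (pt t) - ((1 - t) * f x + t * f y) with hg
  have hpt_mem : ∀ t ∈ Icc (0 : ℝ) 1, pt t ∈ Ioo a b := fun t ht =>
    (convex_Ioo a b) hx hy (by linarith [ht.2]) ht.1 (by ring)
  have hgc : ContinuousOn g (Icc 0 1) := by
    have hptc : Continuous pt := by simp only [hpt]; fun_prop
    refine ((hcont.comp hptc.continuousOn hpt_mem).sub ?_)
    fun_prop
  have hg0 : g 0 = 0 := by simp [hg, hpt]
  have hg1 : g 1 = 0 := by simp [hg, hpt]
  -- midpoint convexity of `g` on `[0,1]`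
  have hgmid : ∀ u ∈ Icc (0 : ℝ) 1, ∀ w ∈ Icc (0 : ℝ) 1, g ((u + w) / 2) ≤ (g u + g w) / 2 := by
    intro u hu w hw
    have h := hmid (pt u) (hpt_mem u hu) (pt w) (hpt_mem w hw)
    have hmidpt : pt ((u + w) / 2) = (pt u + pt w) / 2 := by simp only [hpt]; ring
    simp only [hg]
    rw [hmidpt]
    have : (1 - (u + w) / 2) * f x + (u + w) / 2 * f y =
        (((1 - u) * f x + u * f y) + ((1 - w) * f x + w * f y)) / 2 := by ring
    rw [this]
    linarith
  -- it suffices to show `g ≤ 0` on `[0,1]`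
  suffices hneg : ∀ t ∈ Icc (0 : ℝ) 1, g t ≤ 0 by
    have hq1 : q ∈ Icc (0 : ℝ) 1 := ⟨hq, by linarith⟩
    have := hneg q hq1
    simp only [hg, hpt, smul_eq_mul] at this ⊢
    have hp' : p = 1 - q := by linarith
    rw [hp']
    linarith
  by_contra hcon
  push Not at hcon
  obtain ⟨t₀, ht₀, hgt₀⟩ := hcon
  -- the maximum of `g` on `[0,1]` is positive and attained; take the LAST maximiser
  obtain ⟨t₁, ht₁, hmax⟩ := isCompact_Icc.exists_isMaxOn ⟨t₀, ht₀⟩ hgc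
  set M := g t₁ with hM
  have hM0 : 0 < M := hgt₀.trans_le (hmax ht₀)
  set A : Set ℝ := Icc 0 1 ∩ g ⁻¹' {M} with hA
  have hAc : IsClosed A := hgc.preimage_isClosed_of_isClosed isClosed_Icc isClosed_singleton
  have hAne : A.Nonempty := ⟨t₁, ht₁, rfl⟩
  have hAbdd : BddAbove A := ⟨1, fun t ht => ht.1.2⟩
  set t₂ := sSup A with ht₂
  have ht₂A : t₂ ∈ A := hAc.csSup_mem hAne hAbdd
  obtain ⟨ht₂I, ht₂M⟩ := ht₂A
  have ht₂M : g t₂ = M := ht₂M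
  have ht₂0 : 0 < t₂ := lt_of_le_of_ne ht₂I.1 fun h => by rw [← h, hg0] at ht₂M; linarith
  have ht₂1 : t₂ < 1 := lt_of_le_of_ne ht₂I.2 fun h => by rw [h, hg1] at ht₂M; linarith
  -- step beyond `t₂`
  set h : ℝ := min t₂ (1 - t₂) with hh
  have hh0 : 0 < h := lt_min ht₂0 (by linarith)
  have hu : t₂ - h ∈ Icc (0 : ℝ) 1 := ⟨by simp only [hh]; linarith [min_le_left t₂ (1 - t₂)],
    by linarith⟩
  have hw : t₂ + h ∈ Icc (0 : ℝ) 1 := ⟨by linarith,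
    by simp only [hh]; linarith [min_le_right t₂ (1 - t₂)]⟩
  have hmid₂ := hgmid (t₂ - h) hu (t₂ + h) hw
  rw [show (t₂ - h + (t₂ + h)) / 2 = t₂ by ring, ht₂M] at hmid₂
  have hgu : g (t₂ - h) ≤ M := hmax hu
  have hgwM : g (t₂ + h) = M := le_antisymm (hmax hw) (by linarith)
  have := le_csSup hAbdd (show t₂ + h ∈ A from ⟨hw, hgwM⟩)
  linarith

/-! ### Finiteness and continuity of `e⁺` below the critical density -/

section Envelope

variable {v : ℝ → ℝ≥0∞}

/-- Below the critical density the upper energy per particle is finite. [cite: Ruelle1969, §3.5.11] -/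
theorem limsupEnergyPerParticle_lt_top_of_lt_criticalDensity {x : ℝ} (hx : 0 < x)
    (hcap : ENNReal.ofReal x < criticalDensity v) : limsupEnergyPerParticle v x < ⊤ := by
  rw [criticalDensity] at hcap
  simp only [lt_iSup_iff, exists_prop] at hcap
  obtain ⟨ρ₁, ⟨hρ₁, hfin⟩, hxρ₁⟩ := hcap
  rw [ENNReal.ofReal_lt_ofReal_iff hρ₁] at hxρ₁
  exact (limsupEnergyPerParticle_mono v hx hxρ₁.le).trans_lt hfin

/-- **Continuity of `e⁺` below the critical density**: `ρ ↦ e⁺(ρ)` (real-valued) is continuous at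
every `0 < x < ρ_c(v)` — it is monotone and its envelopes from above and from below agree
(`iInf_limsup_le_iSup_limsup_of_lt_criticalDensity`). [cite: Ruelle1969, §3.5.11] -/
theorem continuousAt_toReal_limsupEnergyPerParticle (hv : IsRepulsiveFiniteRange v) {x : ℝ}
    (hx : 0 < x) (hcap : ENNReal.ofReal x < criticalDensity v) :
    ContinuousAt (fun y => (limsupEnergyPerParticle v y).toReal) x := by
  set E := limsupEnergyPerParticle v with hE
  have hfin : E x < ⊤ := limsupEnergyPerParticle_lt_top_of_lt_criticalDensity hx hcap
  have hGpGm : (⨅ (ρ : ℝ) (_ : x < ρ), E ρ) ≤ ⨆ (ρ : ℝ) (_ : 0 < ρ ∧ ρ < x), E ρ :=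
    iInf_limsup_le_iSup_limsup_of_lt_criticalDensity hv hx hcap
  have h1 : E x ≤ ⨅ (ρ : ℝ) (_ : x < ρ), E ρ :=
    le_iInf₂ fun ρ hρ => limsupEnergyPerParticle_mono v hx (le_of_lt hρ)
  have h2 : (⨆ (ρ : ℝ) (_ : 0 < ρ ∧ ρ < x), E ρ) ≤ E x :=
    iSup₂_le fun ρ hρ => limsupEnergyPerParticle_mono v hρ.1 hρ.2.le
  have hGp : (⨅ (ρ : ℝ) (_ : x < ρ), E ρ) = E x := le_antisymm (hGpGm.trans h2) h1
  have hGm : (⨆ (ρ : ℝ) (_ : 0 < ρ ∧ ρ < x), E ρ) = E x := le_antisymm h2 (h1.trans hGpGm)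
  -- `E` tends to `E x` at `x` in `ℝ≥0∞`
  have hT : Tendsto E (𝓝 x) (𝓝 (E x)) := by
    rw [tendsto_order]
    constructor
    · intro c hc
      rw [← hGm] at hc
      simp only [lt_iSup_iff, exists_prop] at hc
      obtain ⟨ρ₁, ⟨hρ₁, hρ₁x⟩, hcρ₁⟩ := hc
      filter_upwards [Ioi_mem_nhds hρ₁x] with y hy
      exact hcρ₁.trans_le (limsupEnergyPerParticle_mono v hρ₁ (le_of_lt hy))
    · intro c hc
      rw [← hGp] at hc
      simp only [iInf_lt_iff, exists_prop] at hc
      obtain ⟨ρ₂, hxρ₂, hρ₂c⟩ := hc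
      filter_upwards [Ioo_mem_nhds (half_lt_self hx) hxρ₂] with y hy
      exact (limsupEnergyPerParticle_mono v (lt_trans (half_pos hx) hy.1) hy.2.le).trans_lt hρ₂c
  exact (ENNReal.tendsto_toReal hfin.ne).comp hT

/-- **Midpoint convexity of the energy density `ρ e⁺(ρ)`** below the critical density:
`(y + z) e⁺((y+z)/2) ≤ y e⁺(y) + z e⁺(z)` (real values).  From the almost-midpoint convexity
`convexity_ineq` (cells of two kinds filling a large box) by letting the auxiliary densities tend to
`y`, `z` and `(y+z)/2`, using the continuity of `e⁺`. [cite: Ruelle1969, §3.5.11] -/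
theorem midpoint_convexity_energyDensity (hv : IsRepulsiveFiniteRange v) {y z : ℝ} (hy : 0 < y)
    (hz : 0 < z) (hyc : ENNReal.ofReal y < criticalDensity v)
    (hzc : ENNReal.ofReal z < criticalDensity v) :
    (y + z) * (limsupEnergyPerParticle v ((y + z) / 2)).toReal ≤
      y * (limsupEnergyPerParticle v y).toReal + z * (limsupEnergyPerParticle v z).toReal := by
  obtain ⟨R, hR, hv0⟩ := hv.exists_pos_range
  set E := limsupEnergyPerParticle v with hE
  set m : ℝ := (y + z) / 2 with hm
  have hm0 : 0 < m := by positivity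
  have hmc : ENNReal.ofReal m < criticalDensity v := by
    rcases le_total y z with h | h
    · exact lt_of_le_of_lt (ENNReal.ofReal_le_ofReal (by rw [hm]; linarith)) hzc
    · exact lt_of_le_of_lt (ENNReal.ofReal_le_ofReal (by rw [hm]; linarith)) hyc
  have hyT : E y ≠ ⊤ := (limsupEnergyPerParticle_lt_top_of_lt_criticalDensity hy hyc).ne
  have hzT : E z ≠ ⊤ := (limsupEnergyPerParticle_lt_top_of_lt_criticalDensity hz hzc).ne
  have hmT : E m ≠ ⊤ := (limsupEnergyPerParticle_lt_top_of_lt_criticalDensity hm0 hmc).ne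
  set em := (E m).toReal with hem
  have hem0 : 0 ≤ em := ENNReal.toReal_nonneg
  have hcont := continuousAt_toReal_limsupEnergyPerParticle hv hm0 hmc
  refine le_of_forall_pos_le_add fun ε hε => ?_
  -- continuity at `m`: `e(x) ≥ e(m) - ε₁` for `x` close to `m`
  set ε₁ : ℝ := ε / (2 * (y + z)) with hε₁_def
  have hε₁ : 0 < ε₁ := by positivity
  have hev := (Metric.tendsto_nhds.1 hcont) ε₁ hε₁
  obtain ⟨η, hη, hηball⟩ := Metric.eventually_nhds_iff.1 hev
  -- the step
  set s : ℝ := min (η / 4) (min (min y z / 4) (ε / (4 * (em + 1)))) with hs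
  have hs0 : 0 < s := by positivity
  have hsη : 2 * s < η := by
    have : s ≤ η / 4 := min_le_left _ _
    linarith
  have hsmin : s ≤ min y z / 4 := (min_le_right _ _).trans (min_le_left _ _)
  have hminpos : 0 < min y z := lt_min hy hz
  have hsy : s < y := by linarith [min_le_left y z]
  have hsz : s < z := by linarith [min_le_right y z]
  have hminm : min y z ≤ m := by
    rw [hm]; rcases le_total y z with h | h
    · rw [min_eq_left h]; linarith
    · rw [min_eq_right h]; linarith
  have hsε : s * (em + 1) ≤ ε / 4 := by
    have : s ≤ ε / (4 * (em + 1)) := (min_le_right _ _).trans (min_le_right _ _)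
    rwa [le_div_iff₀ (by positivity), ← mul_assoc, mul_comm s 4, mul_assoc,
      ← le_div_iff₀' (by norm_num : (0 : ℝ) < 4)] at this
  set x : ℝ := m - 2 * s with hx
  have hx0 : 0 < x := by rw [hx]; linarith
  have hconv := convexity_ineq hv.1 hv0 hR (x := x) (y' := y - s) (y := y) (z' := z - s) (z := z)
    hx0 (by linarith) (by linarith) (by linarith) (by linarith) (by rw [hx, hm]; linarith)
  -- `e(x) ≥ e(m) - ε₁`
  have hxm : dist x m < η := by
    rw [Real.dist_eq, hx, show m - 2 * s - m = -(2 * s) by ring, abs_neg, abs_of_pos (by positivity)]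
    exact hsη
  have hex : em - ε₁ ≤ (E x).toReal := by
    have h := hηball hxm
    rw [Real.dist_eq] at h
    have := (abs_lt.1 h).1
    linarith
  have hxT : E x ≠ ⊤ := ne_top_of_le_ne_top hmT (limsupEnergyPerParticle_mono v hx0 (by
    rw [hx]; linarith))
  -- pass `hconv` to the reals
  have hfinR : ENNReal.ofReal y * E y + ENNReal.ofReal z * E z ≠ ⊤ :=
    ENNReal.add_ne_top.2 ⟨ENNReal.mul_ne_top ENNReal.ofReal_ne_top hyT,
      ENNReal.mul_ne_top ENNReal.ofReal_ne_top hzT⟩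
  have hreal := ENNReal.toReal_mono hfinR hconv
  rw [ENNReal.toReal_add (ENNReal.mul_ne_top ENNReal.ofReal_ne_top hyT)
      (ENNReal.mul_ne_top ENNReal.ofReal_ne_top hzT), ENNReal.toReal_mul, ENNReal.toReal_mul,
    ENNReal.toReal_mul, ENNReal.toReal_ofReal (by linarith), ENNReal.toReal_ofReal hy.le,
    ENNReal.toReal_ofReal hz.le] at hreal
  -- `hreal : (y - s + (z - s)) e(x) ≤ y e(y) + z e(z)`
  have h1 : (y - s + (z - s)) * (em - ε₁) ≤ (y - s + (z - s)) * (E x).toReal :=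
    mul_le_mul_of_nonneg_left hex (by linarith)
  have h2 : (y + z) * em ≤ (y - s + (z - s)) * (em - ε₁) + 2 * s * em + (y + z) * ε₁ := by
    nlinarith
  have h3 : (y + z) * ε₁ = ε / 2 := by rw [hε₁_def]; field_simp
  have h4 : 2 * s * em ≤ ε / 2 := by nlinarith
  linarith

/-- **Convexity of the energy density below the critical density**: for `0 < ρ̄` with
`ofReal ρ̄ ≤ ρ_c(v)`, `ρ ↦ ρ e⁺(ρ)` is convex on `(0, ρ̄)`. [cite: Ruelle1969, §3.4.4 and §3.5.11] -/
theorem convexOn_energyDensity (hv : IsRepulsiveFiniteRange v) {ρbar : ℝ}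
    (hcap : ENNReal.ofReal ρbar ≤ criticalDensity v) :
    ConvexOn ℝ (Ioo 0 ρbar) fun ρ => ρ * (limsupEnergyPerParticle v ρ).toReal := by
  have hlt : ∀ x ∈ Ioo 0 ρbar, ENNReal.ofReal x < criticalDensity v := fun x hx =>
    lt_of_lt_of_le ((ENNReal.ofReal_lt_ofReal_iff (hx.1.trans hx.2)).2 hx.2) hcap
  refine convexOn_of_midpoint_convex_of_continuousOn ?_ ?_
  · intro x hx
    exact (continuousAt_id.mul (continuousAt_toReal_limsupEnergyPerParticle hv hx.1
      (hlt x hx))).continuousWithinAt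
  · intro x hx y hy
    have h := midpoint_convexity_energyDensity hv hx.1 hy.1 (hlt x hx) (hlt y hy)
    have : (x + y) / 2 * (limsupEnergyPerParticle v ((x + y) / 2)).toReal =
        ((x + y) * (limsupEnergyPerParticle v ((x + y) / 2)).toReal) / 2 := by ring
    rw [this]
    linarith

/-! ### The supporting line under a Dirichlet box -/

/-- Ruelle's basic inequality in product form: `n · e⁺(n/(L+2R)³) ≤ E₀^D(n, L)` for `n ≥ 1`,
`L > 0` (two kinds of cells, both with `n` particles). [cite: Ruelle1969, §3.5.11] -/
theorem natCast_mul_limsupEnergyPerParticle_le_groundStateEnergy (hv : Measurable v) {R : ℝ}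
    (hv0 : ∀ r, R < r → v r = 0) (hR : 0 < R) {n : ℕ} (hn : 0 < n) {L : ℝ} (hL : 0 < L) :
    (n : ℝ≥0∞) * limsupEnergyPerParticle v (n / (L + 2 * R) ^ 3) ≤ groundStateEnergy v n L := by
  set ρ : ℝ := n / (L + 2 * R) ^ 3 with hρ
  have hnr : (0 : ℝ) < n := Nat.cast_pos.2 hn
  have hρ0 : 0 < ρ := by positivity
  have hfit : 2 * ρ * (L + R) ^ 3 < (n + n : ℕ) := by
    have h1 : (L + R) ^ 3 < (L + 2 * R) ^ 3 := by
      apply pow_lt_pow_left₀ (by linarith) (by linarith) three_ne_zero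
    have h2 : ρ * (L + R) ^ 3 < n := by
      rw [hρ, div_mul_eq_mul_div, div_lt_iff₀ (by positivity)]
      exact mul_lt_mul_of_pos_left h1 hnr
    push_cast; linarith
  have h := limsup_energyPerParticle_le hv hv0 hR hρ0 hL hfit
  change limsupEnergyPerParticle v ρ ≤ _ at h
  have hnn : ((n + n : ℕ) : ℝ≥0∞) = 2 * n := by push_cast; ring
  rw [hnn, ENNReal.le_div_iff_mul_le (Or.inl (mul_ne_zero two_ne_zero
      (Nat.cast_ne_zero.2 hn.ne'))) (Or.inl (ENNReal.mul_ne_top ENNReal.ofNat_ne_top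
      (ENNReal.natCast_ne_top n))), ← two_mul] at h
  have h2 : 2 * ((n : ℝ≥0∞) * limsupEnergyPerParticle v ρ) ≤ 2 * groundStateEnergy v n L := by
    calc 2 * ((n : ℝ≥0∞) * limsupEnergyPerParticle v ρ)
        = limsupEnergyPerParticle v ρ * (2 * n) := by ring
      _ ≤ 2 * groundStateEnergy v n L := h
  exact (ENNReal.mul_le_mul_iff_right two_ne_zero ENNReal.ofNat_ne_top).1 h2

/-- **The supporting line under a Dirichlet box.**  Let `0 < ρ̄` with `ofReal ρ̄ ≤ ρ_c(v)`, `R > 0`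
a range of `v`, `N ≥ 1` and `n ≤ N` particle numbers, `L > 0`, `ρ⋆ = N/(L+2R)³` and `z` with
`ρ⋆ < z < ρ̄`.  With `e = e⁺` (real-valued) and the chord slope
`S = (z e(z) - ρ⋆ e(ρ⋆))/(z - ρ⋆)` of the convex energy density:
`ofReal (N e(ρ⋆) - (N - n) S) ≤ E₀^D(n, L)` — the box with `n` particles realises the density
`n/(L+2R)³ ≤ ρ⋆` (Ruelle's inequality) and the convex function `ρ e(ρ)` lies above its chords
extended (three-slope inequality). [cite: Ruelle1969, §3.5.11] -/
theorem ofReal_tangent_le_groundStateEnergy (hv : IsRepulsiveFiniteRange v) {R : ℝ} (hR : 0 < R)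
    (hv0 : ∀ r, R < r → v r = 0) {ρbar : ℝ} (hcap : ENNReal.ofReal ρbar ≤ criticalDensity v)
    {N n : ℕ} (hN : 0 < N) (hn : n ≤ N) {L : ℝ} (hL : 0 < L) {z : ℝ}
    (hz : (N : ℝ) / (L + 2 * R) ^ 3 < z) (hzbar : z < ρbar) :
    ENNReal.ofReal (N * (limsupEnergyPerParticle v (N / (L + 2 * R) ^ 3)).toReal -
        ((N : ℝ) - n) * ((z * (limsupEnergyPerParticle v z).toReal -
          N / (L + 2 * R) ^ 3 * (limsupEnergyPerParticle v (N / (L + 2 * R) ^ 3)).toReal) /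
            (z - N / (L + 2 * R) ^ 3))) ≤
      groundStateEnergy v n L := by
  set e : ℝ → ℝ := fun ρ => (limsupEnergyPerParticle v ρ).toReal with he
  set V : ℝ := (L + 2 * R) ^ 3 with hV
  have hV0 : 0 < V := by positivity
  set ρs : ℝ := N / V with hρs
  have hNr : (0 : ℝ) < N := Nat.cast_pos.2 hN
  have hρs0 : 0 < ρs := by positivity
  have hlt : ∀ x, 0 < x → x < ρbar → ENNReal.ofReal x < criticalDensity v := fun x hx hxb =>
    lt_of_lt_of_le ((ENNReal.ofReal_lt_ofReal_iff (hx.trans hxb)).2 hxb) hcap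
  set S : ℝ := (z * e z - ρs * e ρs) / (z - ρs) with hS
  change ENNReal.ofReal (N * e ρs - ((N : ℝ) - n) * S) ≤ groundStateEnergy v n L
  -- the slope is at least `e(ρ⋆)` (monotonicity of `e`)
  have hzρ : 0 < z - ρs := by linarith
  have hez : e ρs ≤ e z := by
    have hzT : limsupEnergyPerParticle v z ≠ ⊤ :=
      (limsupEnergyPerParticle_lt_top_of_lt_criticalDensity (hρs0.trans hz) (hlt z (hρs0.trans hz)
        hzbar)).ne
    exact ENNReal.toReal_mono hzT (limsupEnergyPerParticle_mono v hρs0 hz.le)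
  have hSe : e ρs ≤ S := by
    rw [hS, le_div_iff₀ hzρ]
    nlinarith
  rcases Nat.eq_zero_or_pos n with rfl | hnpos
  · -- no particles: the supporting value is nonpositive
    have : (N : ℝ) * e ρs - ((N : ℝ) - (0 : ℕ)) * S ≤ 0 := by push_cast; nlinarith
    rw [ENNReal.ofReal_of_nonpos this]
    exact bot_le
  -- `n ≥ 1`: Ruelle's inequality at density `ρ̃ = n/V`
  set ρt : ℝ := n / V with hρt
  have hnr : (0 : ℝ) < n := Nat.cast_pos.2 hnpos
  have hρt0 : 0 < ρt := by positivity
  have hρts : ρt ≤ ρs := by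
    rw [hρt, hρs]; exact div_le_div_of_nonneg_right (by exact_mod_cast hn) hV0.le
  have hRu := natCast_mul_limsupEnergyPerParticle_le_groundStateEnergy hv.1 hv0 hR hnpos hL
  change (n : ℝ≥0∞) * limsupEnergyPerParticle v ρt ≤ groundStateEnergy v n L at hRu
  by_cases htop : groundStateEnergy v n L = ⊤
  · rw [htop]; exact le_top
  have hρtT : limsupEnergyPerParticle v ρt ≠ ⊤ :=
    (limsupEnergyPerParticle_lt_top_of_lt_criticalDensity hρt0
      (hlt ρt hρt0 (by linarith))).ne
  have hRuR : (n : ℝ) * e ρt ≤ (groundStateEnergy v n L).toReal := by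
    have := ENNReal.toReal_mono htop hRu
    rwa [ENNReal.toReal_mul, ENNReal.toReal_natCast] at this
  -- convexity: `V φ(ρ̃) ≥ N e(ρ⋆) - (N - n) S`
  have hkey : (N : ℝ) * e ρs - ((N : ℝ) - n) * S ≤ n * e ρt := by
    rcases eq_or_lt_of_le hρts with heq | hlt'
    · -- `n = N`
      have hnN : (n : ℝ) = N := by
        have : (n : ℝ) / V = N / V := heq
        field_simp at this
        linarith
      rw [heq, hnN]; simp
    · have hconv := (convexOn_energyDensity hv hcap).secant_mono_aux1
        (x := ρt) (y := ρs) (z := z) ⟨hρt0, by linarith⟩ ⟨hρs0.trans hz, hzbar⟩ hlt' hz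
      -- `hconv : (z - ρt) φ(ρs) ≤ (z - ρs) φ(ρt) + (ρs - ρt) φ(z)`
      have hdiff : ρs - ρt = ((N : ℝ) - n) / V := by rw [hρs, hρt]; field_simp
      have hφt : ρt * e ρt = n * e ρt / V := by rw [hρt]; field_simp
      have hgoal : (z - ρs) * ((N : ℝ) * e ρs - ((N : ℝ) - n) * S) ≤ (z - ρs) * (n * e ρt) := by
        have hS' : (z - ρs) * S = z * e z - ρs * e ρs := by rw [hS]; field_simp
        have hρsN : (N : ℝ) = ρs * V := by rw [hρs]; field_simp
        -- multiply `hconv` by `V`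
        have h1 : V * ((z - ρt) * (ρs * e ρs)) ≤
            V * ((z - ρs) * (ρt * e ρt) + (ρs - ρt) * (z * e z)) :=
          mul_le_mul_of_nonneg_left hconv hV0.le
        rw [hφt, hdiff] at h1
        have h2 : V * ((z - ρt) * (ρs * e ρs)) = (z - ρt) * (N * e ρs) := by rw [hρsN]; ring
        have h3 : V * ((z - ρs) * (n * e ρt / V) + ((N : ℝ) - n) / V * (z * e z)) =
            (z - ρs) * (n * e ρt) + ((N : ℝ) - n) * (z * e z) := by field_simp
        rw [h2, h3] at h1
        have h4 : z - ρt = (z - ρs) + ((N : ℝ) - n) / V := by rw [← hdiff]; ring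
        rw [h4] at h1
        have h5 : ((N : ℝ) - n) / V * (N * e ρs) = ((N : ℝ) - n) * (ρs * e ρs) := by
          rw [hρsN]; field_simp
        have h1' : (z - ρs) * (N * e ρs) + ((N : ℝ) - n) * (ρs * e ρs) ≤
            (z - ρs) * (n * e ρt) + ((N : ℝ) - n) * (z * e z) := by
          have : (z - ρs + ((N : ℝ) - n) / V) * (N * e ρs) =
              (z - ρs) * (N * e ρs) + ((N : ℝ) - n) / V * (N * e ρs) := by ring
          rw [this, h5] at h1
          exact h1
        calc (z - ρs) * ((N : ℝ) * e ρs - ((N : ℝ) - n) * S)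
            = (z - ρs) * (N * e ρs) - ((N : ℝ) - n) * ((z - ρs) * S) := by ring
          _ = (z - ρs) * (N * e ρs) - ((N : ℝ) - n) * (z * e z - ρs * e ρs) := by rw [hS']
          _ ≤ (z - ρs) * (n * e ρt) := by linarith [h1']
      exact le_of_mul_le_mul_left hgoal hzρ
  calc ENNReal.ofReal ((N : ℝ) * e ρs - ((N : ℝ) - n) * S) ≤ ENNReal.ofReal (n * e ρt) :=
        ENNReal.ofReal_le_ofReal hkey
    _ ≤ ENNReal.ofReal ((groundStateEnergy v n L).toReal) := ENNReal.ofReal_le_ofReal hRuR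
    _ = groundStateEnergy v n L := ENNReal.ofReal_toReal htop

end Envelope

end Literature.MathematicalPhysics.QuantumManyBody.BoseGas

end
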